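import Literature.Combinatorics.Additive.TricoloredSumFreeLowerBoundPeeling
import Literature.Combinatorics.Additive.TricoloredSumFreeLowerBoundPebody
import HarnessLib

/-!
# Compatible triples (Pebody 2018, Theorem 4) in the `Admissible`/`Coupled` API

`TricoloredSumFreeLowerBoundCoupling.lean` and `TricoloredSumFreeLowerBoundPeeling.lean` set up
Pebody's compatible triples with named predicates (`IsCoupling`, `Coupled`, `IsProfile`,
`Admissible`) and prove the explicit couplings (Lemma 9, Corollary 10) and the peeling step
(Lemma 7, Corollary 8). Pebody's Theorem 4 itself is proved in
`TricoloredSumFreeLowerBoundPebody.lean` (`Pebody.theorem4`, stated with the local notations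
`Adm[…]`/`Cpl[…]`, and consumed by the proof of KSS Theorem 2 in
`TricoloredSumFreeLowerBoundThm2.lean`). This file records the one-line translation
`coupled_of_admissible : Admissible m π₁ π₂ π₃ → Coupled m π₁ π₂ π₃`, closing the named API
(the two notions unfold to the same data: `Admissible` asks for nonnegative step-antitone profiles,
`Adm` for antitone ones, which are nonnegative as they vanish above `m`).

## References

* [Peabody2018] L. Pebody, *Proof of a conjecture of Kleinberg–Sawin–Speyer*, Discrete Analysis
  2018:13, arXiv:1608.05740 — Theorem 4.
-/

noncomputable section

open Finset

open scoped BigOperators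

namespace Literature.Combinatorics.Additive.Pebody

/-- **Pebody's Theorem 4** in the `Admissible → Coupled` form: three non-increasing nonnegative
profiles on `[0,m]` of equal mass whose first moments add up to `m` times the mass are the
marginals of a nonnegative weight on `{a + b + c = m}` (a corollary of `Pebody.theorem4`).
[cite: Peabody2018, Theorem 4] -/
theorem coupled_of_admissible {m : ℕ} {π₁ π₂ π₃ : ℕ → ℝ} (h : Admissible m π₁ π₂ π₃) :
    Coupled m π₁ π₂ π₃ := by
  obtain ⟨h1, h2, h3, hm12, hm23, hmom⟩ := h
  obtain ⟨w, hw0, hws, hw1, hw2, hw3⟩ := theorem4 m π₁ π₂ π₃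
    ⟨h1.antitone, h2.antitone, h3.antitone, fun k hk => h1.eq_zero hk, fun k hk => h2.eq_zero hk,
      fun k hk => h3.eq_zero hk, hm12.symm, (hm12.trans hm23).symm, hmom⟩
  exact ⟨w, hw0, fun a b c hne => by_contra fun habc => hne (hws a b c habc), hw1, hw2, hw3⟩

/-- The `S₃`-symmetric coupling of three copies of one admissible profile (symmetrise a coupling
over `S₃`): the form of KSS Theorem 4 in this API. [cite: KleinbergSawinSpeyer2018, Theorem 4] -/
theorem exists_symmetric_coupling {m : ℕ} {ψ : ℕ → ℝ} (h : Admissible m ψ ψ ψ) :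
    ∃ w : ℕ → ℕ → ℕ → ℝ, IsCoupling m ψ ψ ψ w ∧ (∀ a b c, w a b c = w b a c) ∧
      (∀ a b c, w a b c = w a c b) := by
  obtain ⟨w, h0, hs, h1, h2, h3⟩ := coupled_of_admissible h
  refine ⟨fun a b c => (w a b c + w a c b + w b a c + w b c a + w c a b + w c b a) / 6,
    ⟨fun a b c => ?_, fun a b c hne => ?_, fun a => ?_, fun b => ?_, fun c => ?_⟩,
    fun a b c => by ring, fun a b c => by ring⟩
  · have := h0 a b c; have := h0 a c b; have := h0 b a c; have := h0 b c a
    have := h0 c a b; have := h0 c b a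
    positivity
  · by_contra habc
    apply hne
    have z : ∀ x y z : ℕ, x + y + z = a + b + c → w x y z = 0 := by
      intro x y z hxyz; by_contra hw; exact habc (hxyz ▸ (hs x y z hw))
    show (w a b c + w a c b + w b a c + w b c a + w c a b + w c b a) / 6 = 0
    rw [z a b c (by ring), z a c b (by ring), z b a c (by ring), z b c a (by ring), z c a b (by ring),
      z c b a (by ring)]
    norm_num
  · have e : ∀ b, (∑ c ∈ range (m + 1),
        (w a b c + w a c b + w b a c + w b c a + w c a b + w c b a) / 6) =
        (∑ c ∈ range (m + 1), w a b c + ∑ c ∈ range (m + 1), w a c b +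
          ∑ c ∈ range (m + 1), w b a c + ∑ c ∈ range (m + 1), w b c a +
          ∑ c ∈ range (m + 1), w c a b + ∑ c ∈ range (m + 1), w c b a) / 6 := by
      intro b; rw [← Finset.sum_div]; simp only [Finset.sum_add_distrib]
    rw [Finset.sum_congr rfl (fun b _ => e b), ← Finset.sum_div]
    simp only [Finset.sum_add_distrib]
    have m2 : ∑ b ∈ range (m + 1), ∑ c ∈ range (m + 1), w a c b = ψ a := by
      rw [Finset.sum_comm]; exact h1 a
    have m5 : ∑ b ∈ range (m + 1), ∑ c ∈ range (m + 1), w c a b = ψ a := by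
      rw [Finset.sum_comm]; exact h2 a
    have m6 : ∑ b ∈ range (m + 1), ∑ c ∈ range (m + 1), w c b a = ψ a := by
      rw [Finset.sum_comm]; exact h3 a
    rw [h1 a, m2, h2 a, h3 a, m5, m6]; ring
  · have e : ∀ a, (∑ c ∈ range (m + 1),
        (w a b c + w a c b + w b a c + w b c a + w c a b + w c b a) / 6) =
        (∑ c ∈ range (m + 1), w a b c + ∑ c ∈ range (m + 1), w a c b +
          ∑ c ∈ range (m + 1), w b a c + ∑ c ∈ range (m + 1), w b c a +
          ∑ c ∈ range (m + 1), w c a b + ∑ c ∈ range (m + 1), w c b a) / 6 := by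
      intro a; rw [← Finset.sum_div]; simp only [Finset.sum_add_distrib]
    rw [Finset.sum_congr rfl (fun a _ => e a), ← Finset.sum_div]
    simp only [Finset.sum_add_distrib]
    -- Σ_a Σ_c w a b c = ψ b (h2); Σ_a Σ_c w a c b = ψ b (h3); Σ_a Σ_c w b a c = ψ b (h1 b);
    -- Σ_a Σ_c w b c a = ψ b (h1 via comm); Σ_a Σ_c w c a b: = Σ_c Σ_a w c a b = h3? (third slot b): yes
    have m4 : ∑ a ∈ range (m + 1), ∑ c ∈ range (m + 1), w b c a = ψ b := by
      rw [Finset.sum_comm]; exact h1 b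
    have m5 : ∑ a ∈ range (m + 1), ∑ c ∈ range (m + 1), w c a b = ψ b := by
      rw [Finset.sum_comm]; exact h3 b
    have m6 : ∑ a ∈ range (m + 1), ∑ c ∈ range (m + 1), w c b a = ψ b := by
      rw [Finset.sum_comm]; exact h2 b
    rw [h2 b, h3 b, h1 b, m4, m5, m6]; ring
  · have e : ∀ a, (∑ b ∈ range (m + 1),
        (w a b c + w a c b + w b a c + w b c a + w c a b + w c b a) / 6) =
        (∑ b ∈ range (m + 1), w a b c + ∑ b ∈ range (m + 1), w a c b +
          ∑ b ∈ range (m + 1), w b a c + ∑ b ∈ range (m + 1), w b c a +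
          ∑ b ∈ range (m + 1), w c a b + ∑ b ∈ range (m + 1), w c b a) / 6 := by
      intro a; rw [← Finset.sum_div]; simp only [Finset.sum_add_distrib]
    rw [Finset.sum_congr rfl (fun a _ => e a), ← Finset.sum_div]
    simp only [Finset.sum_add_distrib]
    -- Σ_a Σ_b w a b c = ψ c (h3); w a c b: Σ_a Σ_b = h2 c; w b a c: comm → h3 c; w b c a: comm → h2 c;
    -- w c a b: h1 c; w c b a: comm → h1 c
    have m3 : ∑ a ∈ range (m + 1), ∑ b ∈ range (m + 1), w b a c = ψ c := by
      rw [Finset.sum_comm]; exact h3 c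
    have m4 : ∑ a ∈ range (m + 1), ∑ b ∈ range (m + 1), w b c a = ψ c := by
      rw [Finset.sum_comm]; exact h2 c
    have m6 : ∑ a ∈ range (m + 1), ∑ b ∈ range (m + 1), w c b a = ψ c := by
      rw [Finset.sum_comm]; exact h1 c
    rw [h3 c, h2 c, m3, m4, h1 c, m6]; ring

end Literature.Combinatorics.Additive.Pebody
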